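import Summits.QuantumFields.YangMills.Theorems.VirialFluxGapRingChartPhase
import Literature.MathematicalPhysics.QuantumFieldTheory.ConstructiveQFTBalabanRGStability3Proofs
import HarnessLib

/-!
# Route `VirialFluxGap` (YangMills): a POLYNOMIAL UPPER BOUND for the twisted ring deficit, `F_z(P) ≤ 120·L⁴`
# (the bound `E ≤ K·L^q` of the exceptional term `E = 2F₀·𝟙{F₀ ≥ t₀/2}` in «EulerField» ∕ «EulerFieldFix»)

Toward the deciding crux `VirialFluxGap.PeriodicSoftness` (item stmt-QuantumFields-24141), resolvent Euler field (memo
`fcl-p3-g40-RESOLVENT-EULER-FIELD-24141-v3.md` §3(c)).  The consumer records «EulerField(Fix)» carry an exceptional term `E` with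
`0 ≤ E ≤ K·L^q` and `E = 0` where `F₀ < (K·L^q)⁻¹`; the natural choice `E = 2F₀·𝟙{F₀ ≥ t₀/2}` needs an explicit polynomial bound on `F₀`,
which the tree had only in non-explicit form (✓`exists_abs_ringDeficit_le`).  From ✓`ChartPhase.ringDeficit_eq_matrix_sums` (three families
of unitary costs `2 − Re tr(UVᴴ) ≤ 4`, `|Re tr g| ≤ 2` on `SU(2)` ✓`su2_abs_trace_re_le`):

* `two_sub_re_trace_mul_conjTranspose_le` (`2 − Re tr(U Vᴴ) ≤ 4` for `U, V ∈ SU(2)`), `card_plaquette_three_le` (`#Plaquette 3 L ≤ 9L³`),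
  `wilsonAction_su2Rep_le` (`S(U) ≤ 36L³`), ★ `ringDeficit_le_poly` (`F_z(P) ≤ 120·L⁴`, every twist `z`, every `P`).

HONEST LABEL: one letter; the Euler field is NOT assembled; ⟨24141⟩, ⟨22884⟩ remain OPEN; the Yang–Mills mass gap is NOT proved; no summit is
proved by a line.  THEOREMS ONLY (0 `def`, 0 `sorry`), standard axioms.  Explicit-unit seat `ym-line-fcl-p3` g40 (cell ym-idea-1, free hands),
`--supports stmt-QuantumFields-24141`.  References: [cite: Luscher1983, §2]; [folklore].
-/

set_option autoImplicit false

noncomputable section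

open scoped Matrix BigOperators
open Matrix
open Literature.MathematicalPhysics.QuantumFieldTheory hiding SU2
open Literature.MathematicalPhysics.QuantumLattice

namespace Summit.QuantumFields.YangMills.Theorems.VirialFluxGap.RingDeficit

open Summit.QuantumFields.YangMills.Theorems.FemtoTransferGap
open Summit.QuantumFields.YangMills.Theorems.FemtoTransferGap.TT
open Summit.QuantumFields.YangMills.Theorems.VirialFluxGap.ChartPhase

variable {L : ℕ} [NeZero L]

/-- A unitary cost is at most `4`: `2 − Re tr(U Vᴴ) ≤ 4` for `U, V ∈ SU(2)`. [folklore] -/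
theorem two_sub_re_trace_mul_conjTranspose_le (U V : SU2) :
    (2 : ℝ) - (((U : Matrix (Fin 2) (Fin 2) ℂ) * (V : Matrix (Fin 2) (Fin 2) ℂ)ᴴ).trace).re ≤ 4 := by
  have h1 : (((U : Matrix (Fin 2) (Fin 2) ℂ) * (V : Matrix (Fin 2) (Fin 2) ℂ)ᴴ).trace).re = (((U * V⁻¹ : SU2) : Matrix (Fin 2) (Fin 2) ℂ).trace).re := by
    rw [← re_trace_su2Rep_mul_inv_eq_matrix, fundamentalRep_apply]
  rw [h1]
  have h2 := su2_abs_trace_re_le (U * V⁻¹)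
  rw [abs_le] at h2
  linarith [h2.1]

/-- `#Plaquette 3 L ≤ 9·L³`. [folklore] -/
theorem card_plaquette_three_le : (Fintype.card (Plaquette 3 L) : ℝ) ≤ 9 * (L : ℝ) ^ 3 := by
  have h : Fintype.card (Plaquette 3 L) ≤ 9 * L ^ 3 := by
    rw [Fintype.card_prod, Fintype.card_fun, ZMod.card, Fintype.card_fin, mul_comm]
    refine Nat.mul_le_mul_right _ ?_
    calc Fintype.card {p : Fin 3 × Fin 3 // p.1 < p.2} ≤ Fintype.card (Fin 3 × Fin 3) := Fintype.card_subtype_le _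
      _ = 9 := by rw [Fintype.card_prod, Fintype.card_fin]
  exact_mod_cast h

/-- The Wilson action of an `SU(2)` configuration in the fundamental representation is at most `36·L³`. [folklore] -/
theorem wilsonAction_su2Rep_le (U : GaugeConfig 3 L SU2) : wilsonAction su2Rep U ≤ 36 * (L : ℝ) ^ 3 := by
  unfold wilsonAction
  have hterm : ∀ p : Plaquette 3 L, ((2 : ℕ) : ℝ) - (su2Rep (plaquetteHolonomy U p.1 p.2.1.1 p.2.1.2)).trace.re ≤ 4 := by
    intro p
    rw [fundamentalRep_apply]
    have h2 := su2_abs_trace_re_le (plaquetteHolonomy U p.1 p.2.1.1 p.2.1.2)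
    rw [abs_le] at h2
    push_cast
    linarith [h2.1]
  calc ∑ p : Plaquette 3 L, (((2 : ℕ) : ℝ) - (su2Rep (plaquetteHolonomy U p.1 p.2.1.1 p.2.1.2)).trace.re)
      ≤ ∑ _p : Plaquette 3 L, (4 : ℝ) := Finset.sum_le_sum fun p _ => hterm p
    _ = 4 * Fintype.card (Plaquette 3 L) := by rw [Finset.sum_const, Finset.card_univ, nsmul_eq_mul]; ring
    _ ≤ 4 * (9 * (L : ℝ) ^ 3) := mul_le_mul_of_nonneg_left card_plaquette_three_le (by norm_num)
    _ = 36 * (L : ℝ) ^ 3 := by ring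

/-- ★ **A polynomial upper bound for the twisted ring deficit**: `F_z(P) ≤ 120·L⁴` for every twist `z` and every ring history `P`
(`(2L−1)·3L³` kinetic costs `≤ 4`, `3L³` seam costs `≤ 4`, `2L` Wilson actions `≤ 36L³`). [cite: Luscher1983, §2] -/
theorem ringDeficit_le_poly (z : Fin 3 → Bool) (P : (Fin (2 * L - 1 + 1) → GaugeConfig 3 L SU2) × (Site 3 L → SU2)) :
    ringDeficit L z P ≤ 120 * (L : ℝ) ^ 4 := by
  rw [ringDeficit_eq_matrix_sums]
  have hL1 : (1 : ℝ) ≤ L := by exact_mod_cast NeZero.one_le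
  have hcE : (Fintype.card (Edge 3 L) : ℝ) = 3 * (L : ℝ) ^ 3 := by
    simp only [Fintype.card_prod, Fintype.card_fun, ZMod.card, Fintype.card_fin]
    push_cast; ring
  have hcF : (Fintype.card (Fin (2 * L - 1)) : ℝ) ≤ 2 * L := by
    rw [Fintype.card_fin]
    have : ((2 * L - 1 : ℕ) : ℝ) ≤ ((2 * L : ℕ) : ℝ) := by exact_mod_cast Nat.sub_le _ _
    push_cast at this
    linarith
  have hcF' : (Fintype.card (Fin (2 * L - 1 + 1)) : ℝ) = 2 * L := by
    rw [Fintype.card_fin]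
    have : 2 * L - 1 + 1 = 2 * L := by have := NeZero.one_le (n := L); omega
    rw [this]; push_cast; ring
  -- kinetic family
  have hT : (∑ i : Fin (2 * L - 1), ∑ e : Edge 3 L,
      ((2 : ℝ) - (((P.1 i.castSucc e : Matrix (Fin 2) (Fin 2) ℂ) * (P.1 i.succ e : Matrix (Fin 2) (Fin 2) ℂ)ᴴ).trace).re)) ≤
      2 * L * (3 * (L : ℝ) ^ 3 * 4) := by
    calc _ ≤ ∑ _i : Fin (2 * L - 1), ∑ _e : Edge 3 L, (4 : ℝ) :=
          Finset.sum_le_sum fun i _ => Finset.sum_le_sum fun e _ => two_sub_re_trace_mul_conjTranspose_le _ _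
      _ = (Fintype.card (Fin (2 * L - 1)) : ℝ) * ((Fintype.card (Edge 3 L) : ℝ) * 4) := by
          simp only [Finset.sum_const, Finset.card_univ, nsmul_eq_mul]
      _ ≤ 2 * L * (3 * (L : ℝ) ^ 3 * 4) := by
          rw [hcE]; exact mul_le_mul_of_nonneg_right hcF (by positivity)
  -- seam family
  have hS : (∑ e : Edge 3 L, ((2 : ℝ) - (((P.1 (Fin.last (2 * L - 1)) e : Matrix (Fin 2) (Fin 2) ℂ) *
      ((gaugeTransform P.2 (twist3 z (P.1 0)) e : SU2) : Matrix (Fin 2) (Fin 2) ℂ)ᴴ).trace).re)) ≤ 3 * (L : ℝ) ^ 3 * 4 := by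
    calc _ ≤ ∑ _e : Edge 3 L, (4 : ℝ) := Finset.sum_le_sum fun e _ => two_sub_re_trace_mul_conjTranspose_le _ _
      _ = (Fintype.card (Edge 3 L) : ℝ) * 4 := by simp only [Finset.sum_const, Finset.card_univ, nsmul_eq_mul]
      _ = 3 * (L : ℝ) ^ 3 * 4 := by rw [hcE]
  -- Wilson actions
  have hW : ∑ j : Fin (2 * L - 1 + 1), wilsonAction su2Rep (P.1 j) ≤ 2 * L * (36 * (L : ℝ) ^ 3) := by
    calc _ ≤ ∑ _j : Fin (2 * L - 1 + 1), 36 * (L : ℝ) ^ 3 := Finset.sum_le_sum fun j _ => wilsonAction_su2Rep_le _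
      _ = (Fintype.card (Fin (2 * L - 1 + 1)) : ℝ) * (36 * (L : ℝ) ^ 3) := by simp only [Finset.sum_const, Finset.card_univ, nsmul_eq_mul]
      _ = 2 * L * (36 * (L : ℝ) ^ 3) := by rw [hcF']
  have hL3 : (L : ℝ) ^ 3 ≤ (L : ℝ) ^ 4 := by
    calc (L : ℝ) ^ 3 = (L : ℝ) ^ 3 * 1 := (mul_one _).symm
      _ ≤ (L : ℝ) ^ 3 * L := mul_le_mul_of_nonneg_left hL1 (by positivity)
      _ = (L : ℝ) ^ 4 := by ring
  nlinarith [hT, hS, hW, hL3]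

end Summit.QuantumFields.YangMills.Theorems.VirialFluxGap.RingDeficit

end
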